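import Summits.QuantumFields.YangMills.Theorems.LuscherReductionDressedRitzPolyakovLiftBasisGeneric
import HarnessLib

/-!
# Route `LuscherReduction`, item `DressedRitz` (stmt-QuantumFields-20205), line «polyakovlift» — the four stub texts and their composition
# PARAMETRIC IN AN `L`-ADAPTED ONE-SITE BASIS PREDICATE `P L Λ g`

Support module (LEAD prover ym-lead-20205-polyakovlift g2; `--supports stmt-QuantumFields-20205`).  Companion of `…PolyakovLiftBasisGeneric.lean` (basis
predicates `P Λ g`): here the predicate may also read the lattice size, `P : ℕ → ℝ → (Fin k → (GaugeConfig 3 1 SU2 → ℝ)) → Prop`, `P L Λ g` — needed by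
skeleton r6, whose explicit transplanted observables are read through the `L`-ADAPTED root chart `rootCoord L (Λ/2)` (the unique chart in which the Polyakov
power map `powLink L` is an EXACT dilation onto the tree's gnomonic chart at the one-site scale `Λ/(2L)`; an `L`-independent chart costs an `O(1/L²)`
near-identity distortion of every one-site quasimode, i.e. a change-of-variables calculus the line does not need).  Texts and proofs are those of the
companion file verbatim with `P L (luscherLambda β L) g ↦ P L (luscherLambda β L) g` on the fine side and `P Λ g ↦ P L Λ g` on the one-site side:

* `BasisPhysL`, `StaticsForL`, `LeakageForL`, `LiftPositionForL`, `ChannelUniversalityForL`, `PScalingExistsForL`;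
* ★ `liftPositionForL_of_channelUniversality_pscaling`, ★ `operatorPlateauAt_of_partsForL`, ★★★ `dressedRitz_of_partsForL : … → DressedRitz` BY NAME;
* `…ForL_const_iff`: an `L`-blind predicate `fun _ => P` gives back the companion texts.

HONEST FRAMING: typing + pure-real composition on the conditional femto rung R2b1; every `…ForL P` text is OPEN for every interesting `P`; nothing here bears on
infinite volume, the continuum limit or the Clay gap.  References: M. Lüscher, NPB 219 (1983) 233 [cite: Luscher1983, §3]; M. Lüscher, U. Wolff,
NPB 339 (1990) 222 [cite: LuscherWolff1990].
-/

set_option autoImplicit false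

noncomputable section

open MeasureTheory Filter Topology Real
open Literature.MathematicalPhysics.QuantumFieldTheory (GaugeConfig Site gaugeTransform)
open scoped BigOperators

namespace Summit.QuantumFields.YangMills.Theorems.FemtoTransferGap.PolyakovLift

open Summit.QuantumFields.YangMills.Theorems.FemtoTransferGap

variable {k : ℕ}

/-! ## §1 Basis predicates and the four texts -/

/-- A basis predicate `P Λ g` has PHYSICAL members: every `g_i` is a physical one-site function. [folklore] -/
def BasisPhysL (P : ℕ → ℝ → (Fin k → (GaugeConfig 3 1 SU2 → ℝ)) → Prop) : Prop :=
  ∀ (L : ℕ) (Λ : ℝ) (g : Fin k → (GaugeConfig 3 1 SU2 → ℝ)), P L Λ g → ∀ i, IsPhys (g i)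

/-- STATICS for the basis predicate `P` (fine time-0 clauses (o0)(o2) of the dressed lifted family, ∀-basis). [cite: Luscher1983, §3] [cite: LuscherWolff1990] -/
def StaticsForL (P : ℕ → ℝ → (Fin k → (GaugeConfig 3 1 SU2 → ℝ)) → Prop) : Prop :=
  ∃ C lam0 : ℝ, 0 ≤ C ∧ 0 < lam0 ∧ ∀ lam : ℝ, 0 < lam → lam ≤ lam0 → ∃ L0 : ℕ,
    ∀ (L : ℕ) [NeZero L], L0 ≤ L → ∀ β : ℝ, InFemtoWindow lam β L →
      ∀ φ : GaugeConfig 3 L SU2 → ℝ, IsRawVacuum β φ →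
        ∀ g : Fin k → (GaugeConfig 3 1 SU2 → ℝ), P L (luscherLambda β L) g →
          StaticClauses k C β (dressedLiftFamily β φ g)

/-- LEAKAGE for the basis predicate `P` (fine time-2 clause (o4) of the dressed lifted family, ∀-basis). [cite: Luscher1983, §3] [cite: LuscherWolff1990] -/
def LeakageForL (P : ℕ → ℝ → (Fin k → (GaugeConfig 3 1 SU2 → ℝ)) → Prop) : Prop :=
  ∃ C lam0 : ℝ, 0 ≤ C ∧ 0 < lam0 ∧ ∀ lam : ℝ, 0 < lam → lam ≤ lam0 → ∃ L0 : ℕ,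
    ∀ (L : ℕ) [NeZero L], L0 ≤ L → ∀ β : ℝ, InFemtoWindow lam β L →
      ∀ φ : GaugeConfig 3 L SU2 → ℝ, IsRawVacuum β φ →
        ∀ g : Fin k → (GaugeConfig 3 1 SU2 → ℝ), P L (luscherLambda β L) g →
          LeakageClause k C β (dressedLiftFamily β φ g)

/-- POSITION for the basis predicate `P` (∃-basis (o5)(o6) of the dressed lifted family). [cite: Luscher1983, §3] -/
def LiftPositionForL (P : ℕ → ℝ → (Fin k → (GaugeConfig 3 1 SU2 → ℝ)) → Prop) : Prop :=
  ∃ C lam0 : ℝ, 0 ≤ C ∧ 0 < lam0 ∧ ∀ lam : ℝ, 0 < lam → lam ≤ lam0 → ∃ L0 : ℕ,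
    ∀ (L : ℕ) [NeZero L], L0 ≤ L → ∀ β : ℝ, InFemtoWindow lam β L →
      ∀ φ : GaugeConfig 3 L SU2 → ℝ, IsRawVacuum β φ →
        ∃ g : Fin k → (GaugeConfig 3 1 SU2 → ℝ), P L (luscherLambda β L) g ∧
          DynamicCoreClauses k C β (dressedLiftFamily β φ g)

/-- UNIVERSALITY for the basis predicate `P`: the scale-free (A5) + (A6′) of `ChannelUniversalityAt`, ∀-basis (fine dressed family vs one-site shadow at
`B = oneSiteCoupling β L`). [cite: Luscher1983, §3] [cite: LuscherWolff1990] -/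
def ChannelUniversalityForL (P : ℕ → ℝ → (Fin k → (GaugeConfig 3 1 SU2 → ℝ)) → Prop) : Prop :=
  ∃ C lam0 : ℝ, 0 ≤ C ∧ 0 < lam0 ∧ ∀ lam : ℝ, 0 < lam → lam ≤ lam0 → ∃ L0 : ℕ,
    ∀ (L : ℕ) [NeZero L], L0 ≤ L → ∀ β : ℝ, InFemtoWindow lam β L →
      ∀ φ : GaugeConfig 3 L SU2 → ℝ, IsRawVacuum β φ →
        ∀ g : Fin k → (GaugeConfig 3 1 SU2 → ℝ), P L (luscherLambda β L) g →
          ∀ e₀ : GaugeConfig 3 1 SU2 → ℝ, IsRawVacuum (L := 1) (oneSiteCoupling β L) e₀ →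
            let u := dressedLiftFamily β φ g
            let w := shadowFamily (oneSiteCoupling β L) L e₀ g
            let l0 := levelValue su2Rep L β 0
            let m0 := levelValue su2Rep 1 (oneSiteCoupling β L) 0
            (∀ i : Fin k,
              l2 (u i) (transferApply β (u i)) * l2 (w i) (w i) * m0 ≤
                  Real.exp (C * luscherLambda β L ^ 2 / L) * (l2 (w i) (transferApply (oneSiteCoupling β L) (w i)) * l2 (u i) (u i) * l0) ∧
              l2 (w i) (transferApply (oneSiteCoupling β L) (w i)) * l2 (u i) (u i) * l0 ≤
                  Real.exp (C * luscherLambda β L ^ 2 / L) * (l2 (u i) (transferApply β (u i)) * l2 (w i) (w i) * m0)) ∧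
            (∀ i l : Fin k, i ≠ l →
              |(l2 (u i) (transferApply β (u l)) -
                  (l2 (u i) (transferApply β (u i)) / l2 (u i) (u i) + l2 (u l) (transferApply β (u l)) / l2 (u l) (u l)) / 2 *
                    l2 (u i) (u l)) * m0 * (Real.sqrt (l2 (w i) (w i)) * Real.sqrt (l2 (w l) (w l))) -
                (l2 (w i) (transferApply (oneSiteCoupling β L) (w l)) -
                  (l2 (w i) (transferApply (oneSiteCoupling β L) (w i)) / l2 (w i) (w i) +
                      l2 (w l) (transferApply (oneSiteCoupling β L) (w l)) / l2 (w l) (w l)) / 2 * l2 (w i) (w l)) * l0 *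
                  (Real.sqrt (l2 (u i) (u i)) * Real.sqrt (l2 (u l) (u l)))|
                ≤ C * (luscherLambda β L ^ 2 / L) * l0 * m0 *
                  (Real.sqrt (l2 (u i) (u i)) * Real.sqrt (l2 (u l) (u l))) * (Real.sqrt (l2 (w i) (w i)) * Real.sqrt (l2 (w l) (w l))))

/-- PSCALING for the basis predicate `P`: the one-site (o0′)(o5′)(o6′) of `PScalingExistsAt`, ∃-basis (the prover picks the basis at each `Λ`; shadow family at
`B = 2L³/Λ³`, dressed by `dressSteps L` steps). [cite: Luscher1983, §3] -/
def PScalingExistsForL (P : ℕ → ℝ → (Fin k → (GaugeConfig 3 1 SU2 → ℝ)) → Prop) : Prop :=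
  ∃ C lam0 : ℝ, 0 ≤ C ∧ 0 < lam0 ∧ ∀ lam : ℝ, 0 < lam → lam ≤ lam0 → ∃ L0 : ℕ, ∀ L : ℕ, L0 ≤ L →
    ∀ Λ : ℝ, lam ≤ Λ → Λ ≤ 2 * lam →
      ∀ e₀ : GaugeConfig 3 1 SU2 → ℝ, IsRawVacuum (L := 1) (2 * (L : ℝ) ^ 3 / Λ ^ 3) e₀ →
        ∃ g : Fin k → (GaugeConfig 3 1 SU2 → ℝ), P L Λ g ∧
          let B : ℝ := 2 * (L : ℝ) ^ 3 / Λ ^ 3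
          let w : Fin k → (GaugeConfig 3 1 SU2 → ℝ) := shadowFamily B L e₀ g
          let m0 := levelValue su2Rep 1 B 0
          (∀ i : Fin k, 0 < l2 (w i) (w i)) ∧
          (∀ i : Fin k,
            l2 (w i) (transferApply B (w i)) * m0 ≤ Real.exp (C * Λ ^ 2 / L) * (levelValue su2Rep 1 B ((i : ℕ) + 1) * m0) * l2 (w i) (w i) ∧
            levelValue su2Rep 1 B ((i : ℕ) + 1) * m0 * l2 (w i) (w i) ≤ Real.exp (C * Λ ^ 2 / L) * (l2 (w i) (transferApply B (w i)) * m0)) ∧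
          (∀ i l : Fin k, i ≠ l →
            |l2 (w i) (transferApply B (w l)) -
                (l2 (w i) (transferApply B (w i)) / l2 (w i) (w i) + l2 (w l) (transferApply B (w l)) / l2 (w l) (w l)) / 2 *
                  l2 (w i) (w l)|
              ≤ C * (Λ ^ 2 / L) * m0 * (Real.sqrt (l2 (w i) (w i)) * Real.sqrt (l2 (w l) (w l))))

/-! ## §2 Sanity: an `L`-blind predicate gives back the texts of `…PolyakovLiftBasisGeneric.lean` -/

/-- `StaticsForL (fun _ => P) ↔ StaticsFor P`. [folklore] -/
theorem staticsForL_const_iff (P : ℝ → (Fin k → (GaugeConfig 3 1 SU2 → ℝ)) → Prop) : StaticsForL (fun _ => P) ↔ StaticsFor P := Iff.rfl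

/-- `LeakageForL (fun _ => P) ↔ LeakageFor P`. [folklore] -/
theorem leakageForL_const_iff (P : ℝ → (Fin k → (GaugeConfig 3 1 SU2 → ℝ)) → Prop) : LeakageForL (fun _ => P) ↔ LeakageFor P := Iff.rfl

/-- `ChannelUniversalityForL (fun _ => P) ↔ ChannelUniversalityFor P`. [folklore] -/
theorem channelUniversalityForL_const_iff (P : ℝ → (Fin k → (GaugeConfig 3 1 SU2 → ℝ)) → Prop) :
    ChannelUniversalityForL (fun _ => P) ↔ ChannelUniversalityFor P := Iff.rfl

/-- `PScalingExistsForL (fun _ => P) ↔ PScalingExistsFor P`. [folklore] -/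
theorem pscalingExistsForL_const_iff (P : ℝ → (Fin k → (GaugeConfig 3 1 SU2 → ℝ)) → Prop) :
    PScalingExistsForL (fun _ => P) ↔ PScalingExistsFor P := Iff.rfl

/-! ## §3 ★ UNIVERSALITY ∧ PSCALING ⟹ POSITION, for any physical basis predicate -/

/-- ★★ **`ChannelUniversalityForL P ∧ PScalingExistsForL P ⟹ LiftPositionForL P`** (members physical): take the basis supplied by PSCALING at `Λ = λ(β,L)` and the
Perron–Frobenius one-site vacuum, read UNIVERSALITY for it, transfer (o5′) by `o5_transfer` and (o6′) by `o6_transfer_normalised`; constant `C_A + C_B`.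
[cite: Luscher1983, §3] -/
theorem liftPositionForL_of_channelUniversality_pscaling {P : ℕ → ℝ → (Fin k → (GaugeConfig 3 1 SU2 → ℝ)) → Prop} (hP : BasisPhysL P)
    (hA : ChannelUniversalityForL P) (hB : PScalingExistsForL P) : LiftPositionForL P := by
  obtain ⟨CA, lA, hCA, hlA, hAk⟩ := hA
  obtain ⟨CB, lB, hCB, hlB, hBk⟩ := hB
  refine ⟨CA + CB, min lA lB, by positivity, lt_min hlA hlB, fun lam hlam hle => ?_⟩
  obtain ⟨LA, hLA⟩ := hAk lam hlam (hle.trans (min_le_left _ _))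
  obtain ⟨LB, hLB⟩ := hBk lam hlam (hle.trans (min_le_right _ _))
  refine ⟨max LA LB, fun L _ hL β hW φ hφ => ?_⟩
  have hleA : LA ≤ L := (le_max_left _ _).trans hL
  have hleB : LB ≤ L := (le_max_right _ _).trans hL
  have hβ0 : 0 ≤ β := zero_le_one.trans hW.1
  have hΛpos : 0 < luscherLambda β L := luscherLambda_pos_of_window hlam hW
  have hLpos : (0 : ℝ) < L := Nat.cast_pos.mpr (NeZero.pos L)
  have hBpos : 0 < oneSiteCoupling β L := by
    unfold oneSiteCoupling; exact div_pos (mul_pos two_pos (pow_pos hLpos 3)) (pow_pos hΛpos 3)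
  obtain ⟨e₀, θ, c, he₀, -, -, hn₀, heig₀, -, -, -⟩ := PhysL2.exists_groundState (L := 1) (oneSiteCoupling β L)
  have heig₀' : transferApply (oneSiteCoupling β L) e₀ = levelValue su2Rep 1 (oneSiteCoupling β L) 0 • e₀ := by
    rw [levelValue_zero]; exact heig₀
  have hvac₀ : IsRawVacuum (L := 1) (oneSiteCoupling β L) e₀ := ⟨he₀, hn₀, heig₀'⟩
  obtain ⟨g, hbasis, hB0, hB5, hB6⟩ := hLB L hleB (luscherLambda β L) hW.2.1 hW.2.2 e₀ hvac₀
  obtain ⟨hA5, hA6⟩ := hLA L hleA β hW φ hφ g hbasis e₀ hvac₀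
  set u := dressedLiftFamily β φ g with hu
  set w := shadowFamily (oneSiteCoupling β L) L e₀ g with hw
  set l0 := levelValue su2Rep L β 0 with hl0
  set m0 := levelValue su2Rep 1 (oneSiteCoupling β L) 0 with hm0
  have hm0pos : 0 < m0 := levelValue_su2Rep_pos (L := 1) hBpos 0
  have hl0nn : 0 ≤ l0 := levelValue_su2Rep_nonneg L hβ0 0
  have huP : ∀ i, IsPhys (u i) := fun i => isPhys_dressedLiftVec β hφ.1 (hP _ _ _ hbasis i)
  have hEA : 0 < Real.exp (CA * luscherLambda β L ^ 2 / L) := Real.exp_pos _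
  have hEB : 0 < Real.exp (CB * luscherLambda β L ^ 2 / L) := Real.exp_pos _
  have hEE : Real.exp (CA * luscherLambda β L ^ 2 / L) * Real.exp (CB * luscherLambda β L ^ 2 / L) =
      Real.exp ((CA + CB) * luscherLambda β L ^ 2 / L) := by
    rw [← Real.exp_add]; congr 1; ring
  refine ⟨g, hbasis, fun i => ?_, fun i l hil => ?_⟩
  · obtain ⟨h1, h2⟩ := o5_transfer (hB0 i) hm0pos (l2_self_nonneg (u i)) hl0nn hEA hEB (hA5 i).1 (hA5 i).2 (hB5 i).1 (hB5 i).2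
    rw [hEE] at h1 h2
    exact ⟨h1, h2⟩
  · have hsO : 0 < Real.sqrt (l2 (w i) (w i)) * Real.sqrt (l2 (w l) (w l)) :=
      mul_pos (Real.sqrt_pos.mpr (hB0 i)) (Real.sqrt_pos.mpr (hB0 l))
    have hsF : 0 ≤ Real.sqrt (l2 (u i) (u i)) * Real.sqrt (l2 (u l) (u l)) := mul_nonneg (Real.sqrt_nonneg _) (Real.sqrt_nonneg _)
    have h := o6_transfer_normalised (a := CA * (luscherLambda β L ^ 2 / L)) (b := CB * (luscherLambda β L ^ 2 / L)) hm0pos hsO hl0nn hsF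
      (hA6 i l hil) (hB6 i l hil)
    calc _ ≤ (CA * (luscherLambda β L ^ 2 / L) + CB * (luscherLambda β L ^ 2 / L)) * l0 *
            (Real.sqrt (l2 (u i) (u i)) * Real.sqrt (l2 (u l) (u l))) := h
      _ = (CA + CB) * (luscherLambda β L ^ 2 / L) * l0 * (Real.sqrt (l2 (u i) (u i)) * Real.sqrt (l2 (u l) (u l))) := by ring

/-! ## §4 ★ STATICS ∧ POSITION ∧ LEAKAGE ⟹ `OpPlat.OperatorPlateauAt k`, for any physical basis predicate -/

/-- ★ **The three fine parts give `OpPlat.OperatorPlateauAt k`**: PF vacuum `Ω` (`PhysL2.exists_groundState`) fed to the parts; constants merged to `max`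
(`coreClauses_of_parts`); the dressed vectors ARE insertions `ins Ω (u_i'/Ω)` of physical functions (`dressedLiftFamily_eq_ins`, `isPhys_div_rawVacuum`); (o1) by
sorting and (o7) by ONE inside `OpPlat.operatorPlateauAt_of_unorderedCore`. [cite: Luscher1983, §3] [cite: LuscherWolff1990] -/
theorem operatorPlateauAt_of_partsForL {P : ℕ → ℝ → (Fin k → (GaugeConfig 3 1 SU2 → ℝ)) → Prop} (hP : BasisPhysL P)
    (hS : StaticsForL P) (hPos : LiftPositionForL P) (hK : LeakageForL P) : OpPlat.OperatorPlateauAt k := by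
  obtain ⟨C₁, l₁, hC₁, hl₁, h₁⟩ := hS
  obtain ⟨C₂, l₂, -, hl₂, h₂⟩ := hPos
  obtain ⟨C₃, l₃, -, hl₃, h₃⟩ := hK
  apply OpPlat.operatorPlateauAt_of_unorderedCore
  refine ⟨max C₁ (max C₂ C₃), min l₁ (min l₂ l₃), hC₁.trans (le_max_left _ _), lt_min hl₁ (lt_min hl₂ hl₃), fun lam hlam hle => ?_⟩
  obtain ⟨L₁, hL₁⟩ := h₁ lam hlam (hle.trans (min_le_left _ _))
  obtain ⟨L₂, hL₂⟩ := h₂ lam hlam (hle.trans ((min_le_right _ _).trans (min_le_left _ _)))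
  obtain ⟨L₃, hL₃⟩ := h₃ lam hlam (hle.trans ((min_le_right _ _).trans (min_le_right _ _)))
  refine ⟨max L₁ (max L₂ L₃), fun L _ hL β hW => ?_⟩
  have hle₁ : L₁ ≤ L := (le_max_left _ _).trans hL
  have hle₂ : L₂ ≤ L := ((le_max_left _ _).trans (le_max_right _ _)).trans hL
  have hle₃ : L₃ ≤ L := ((le_max_right _ _).trans (le_max_right _ _)).trans hL
  obtain ⟨Ω, θ, c, hΩ, -, -, hn, heig, -, -, -⟩ := PhysL2.exists_groundState (L := L) β
  have heig' : transferApply β Ω = levelValue su2Rep L β 0 • Ω := by rw [levelValue_zero]; exact heig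
  have hvac : IsRawVacuum β Ω := ⟨hΩ, hn, heig'⟩
  obtain ⟨g, hbasis, hpos⟩ := hL₂ L hle₂ β hW Ω hvac
  have hstat := hL₁ L hle₁ β hW Ω hvac g hbasis
  have hleak := hL₃ L hle₃ β hW Ω hvac g hbasis
  have hg : ∀ i, IsPhys (g i) := hP _ _ _ hbasis
  have hu : ∀ i, IsPhys (dressedLiftFamily β Ω g i) := fun i => isPhys_dressedLiftVec β hΩ (hg i)
  obtain ⟨c0, c2, c4, c5, c6⟩ := coreClauses_of_parts hlam hW hu (le_max_left _ _) ((le_max_left _ _).trans (le_max_right _ _))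
    ((le_max_right _ _).trans (le_max_right _ _)) hstat hpos hleak
  exact ⟨Ω, hΩ, hn, heig', dressedLiftFamily β Ω g,
    ⟨fun i => fun U => dressedLiftVec β Ω (g i) U / Ω U, fun i => isPhys_div_rawVacuum β hvac (isPhys_dressedLiftVec β hΩ (hg i)),
      dressedLiftFamily_eq_ins β hvac hg⟩, c0, c2, c4, c5, c6⟩

/-- ★★★ **The four parts prove the route decl `DressedRitz` BY NAME, for any physical basis predicate family `P k`.** [cite: Luscher1983, §3] [cite: LuscherWolff1990] -/
theorem dressedRitz_of_partsForL {P : (k : ℕ) → ℕ → ℝ → (Fin k → (GaugeConfig 3 1 SU2 → ℝ)) → Prop} (hP : ∀ k, BasisPhysL (P k))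
    (hS : ∀ k, StaticsForL (P k)) (hU : ∀ k, ChannelUniversalityForL (P k)) (hB : ∀ k, PScalingExistsForL (P k))
    (hK : ∀ k, LeakageForL (P k)) : Summit.QuantumFields.YangMills.Theses.LuscherReduction.DressedRitz :=
  OpPlat.dressedRitz_of_operatorPlateau fun k =>
    operatorPlateauAt_of_partsForL (hP k) (hS k) (liftPositionForL_of_channelUniversality_pscaling (hP k) (hU k) (hB k)) (hK k)

end Summit.QuantumFields.YangMills.Theorems.FemtoTransferGap.PolyakovLift

end
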